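import Mathlib
import Literature.Computability.AlgebraicComplexity.OrbitAveragingCircuitEval
import Summits.ValiantsHypothesis.ValiantsHypothesis.Theorems.ProofCarryingSymmetryStabilityOfProvableSymmetryInvariance

/-!
# Route ProofCarryingSymmetry — item `StabilityOfProvableSymmetry` (stmt-ValiantsHypothesis-10358): the fixed-`n` form

The item (L, the route's stability bet; untyped at the time of writing — candidate signature by
refuter g44-23, see the item's evidence note) asserts ONE exponent `c` such that for ALL `n`, a
Hrubeš–Tzameret circuit `C` over the matrix variables `x_ij` (`i, j < n`) whose invariance
identities `C∘(k k+1) = C` have `P_c(ℂ)`-proofs of size `≤ t` is computed by an `S_n`-symmetric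
labelled circuit of size `≤ (|C| + t + n + 2)^c`.

This file proves what orbit averaging gives (`PICircuit.exists_isSymmetric_perm_of_rename_eval_eq`,
`Literature/…/OrbitAveragingCircuitEval.lean`) once soundness has made `Ĉ` invariant
(`eval_rename_perm_eq_of_hasPCProofOfSize_adjacent`, sibling file `…Invariance.lean`):

* `exists_isSymmetric_of_hasPCProofOfSize_adjacent(')` — under the hypotheses of L (either
  indexing of the adjacent transpositions) an `S_n`-symmetric circuit of size
  `≤ n² + (2·n! + 1)|C| + 5` computes `Ĉ` — for every `n`, with NO use of `t` beyond soundness;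
* `stability_fixed_n` — hence the `∀ n, ∃ c` form of L (with `c = 2·n! + 6`), in exactly the
  shape of the candidate signature with the two leading quantifiers swapped. The content of L is
  therefore precisely the uniformity of `c` in `n`; in particular its `n ≤ 1` instances hold.
-/

namespace Summit.ValiantsHypothesis.Theorems

open MvPolynomial Literature.Computability.AlgebraicComplexity

namespace ProofCarryingSymmetry

/-- **Fixed-`n` stability by orbit averaging.** If every invariance identity `C∘(i j) = C`,
`j = i + 1`, of a Hrubeš–Tzameret circuit `C` over `ℂ` in the matrix variables has a `P_c`-proof,
then an `S_n`-symmetric labelled circuit of size `≤ n² + (2·n! + 1)|C| + 5` computes `Ĉ`.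
[folklore] -/
theorem exists_isSymmetric_of_hasPCProofOfSize_adjacent {n : ℕ} (C : PICircuit ℂ (Fin n × Fin n))
    (t : ℕ) (h : ∀ i j : Fin n, (j : ℕ) = i + 1 →
      HasPCProofOfSize (C.rename fun x : Fin n × Fin n => Equiv.swap i j • x) C t) :
    ∃ (G : Type) (_ : Fintype G) (D : LabelledArithCircuit ℂ (Fin n × Fin n) Unit G),
      D.IsSymmetric (Equiv.Perm (Fin n)) ∧ D.eval (D.output ()) = C.eval ∧
      Fintype.card G ≤ n ^ 2 + (2 * n.factorial + 1) * C.size + 5 :=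
  C.exists_isSymmetric_perm_of_rename_eval_eq
    (eval_rename_perm_eq_of_hasPCProofOfSize_adjacent C t h)

/-- The same with the adjacent transpositions indexed by `k : ℕ`, `k + 1 < n` (the indexing of
the candidate signature of the item). [folklore] -/
theorem exists_isSymmetric_of_hasPCProofOfSize_adjacent' {n : ℕ} (C : PICircuit ℂ (Fin n × Fin n))
    (t : ℕ) (h : ∀ (k : ℕ) (hk : k + 1 < n), HasPCProofOfSize
      (C.rename fun x : Fin n × Fin n => (Equiv.swap (⟨k, by omega⟩ : Fin n) ⟨k + 1, hk⟩) • x) C t) :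
    ∃ (G : Type) (_ : Fintype G) (D : LabelledArithCircuit ℂ (Fin n × Fin n) Unit G),
      D.IsSymmetric (Equiv.Perm (Fin n)) ∧ D.eval (D.output ()) = C.eval ∧
      Fintype.card G ≤ n ^ 2 + (2 * n.factorial + 1) * C.size + 5 := by
  refine exists_isSymmetric_of_hasPCProofOfSize_adjacent C t fun i j hij => ?_
  have hk : (i : ℕ) + 1 < n := hij ▸ j.isLt
  have hi : (⟨(i : ℕ), by omega⟩ : Fin n) = i := Fin.ext rfl
  have hj : (⟨(i : ℕ) + 1, hk⟩ : Fin n) = j := Fin.ext hij.symm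
  have := h i hk
  rwa [hi, hj] at this

/-- **The `∀ n, ∃ c` form of L holds** (orbit averaging; `c = 2·n! + 6`): for every FIXED `n`
there is `c` with — for all `s, t` and every circuit `C` of size `≤ s` whose adjacent invariance
identities have `P_c(ℂ)`-proofs of size `≤ t` — an `S_n`-symmetric labelled circuit computing `Ĉ`
of size `≤ (s + t + n + 2)^c`. The item `StabilityOfProvableSymmetry` is the same statement with
`∃ c` BEFORE `∀ n`. [folklore] -/
theorem stability_fixed_n (n : ℕ) : ∃ c : ℕ, ∀ (s t : ℕ) (C : PICircuit ℂ (Fin n × Fin n)),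
    C.size ≤ s →
    (∀ (k : ℕ) (hk : k + 1 < n), HasPCProofOfSize
      (C.rename fun x : Fin n × Fin n => (Equiv.swap (⟨k, by omega⟩ : Fin n) ⟨k + 1, hk⟩) • x) C t) →
    ∃ (G : Type) (_ : Fintype G) (D : LabelledArithCircuit ℂ (Fin n × Fin n) Unit G),
      D.IsSymmetric (Equiv.Perm (Fin n)) ∧ D.eval (D.output ()) = C.eval ∧
      Fintype.card G ≤ (s + t + n + 2) ^ c := by
  refine ⟨2 * n.factorial + 6, fun s t C hs h => ?_⟩
  obtain ⟨G, hG, D, hsym, hev, hcard⟩ := exists_isSymmetric_of_hasPCProofOfSize_adjacent' C t h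
  refine ⟨G, hG, D, hsym, hev, ?_⟩
  set m := s + t + n + 2 with hm
  have h1s : 1 ≤ s := C.one_le_size.trans hs
  have hm2 : 2 ≤ m := by omega
  have hnm : n ≤ m := by omega
  have hsm : C.size ≤ m := by omega
  have hmm : m ≤ m ^ 2 := by nlinarith
  have h1 : n ^ 2 ≤ m ^ 2 := Nat.pow_le_pow_left hnm 2
  have h2 : (2 * n.factorial + 1) * C.size ≤ (2 * n.factorial + 1) * m ^ 2 :=
    Nat.mul_le_mul_left _ (hsm.trans hmm)
  have h3 : 5 ≤ 2 * m ^ 2 := by nlinarith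
  have hA : 2 * n.factorial + 4 ≤ m ^ (2 * n.factorial + 4) :=
    (Nat.lt_two_pow_self).le.trans (Nat.pow_le_pow_left hm2 _)
  calc Fintype.card G ≤ n ^ 2 + (2 * n.factorial + 1) * C.size + 5 := hcard
    _ ≤ (2 * n.factorial + 4) * m ^ 2 := by nlinarith [h1, h2, h3]
    _ ≤ m ^ (2 * n.factorial + 4) * m ^ 2 := Nat.mul_le_mul_right _ hA
    _ = m ^ (2 * n.factorial + 6) := by rw [← pow_add]

end ProofCarryingSymmetry

end Summit.ValiantsHypothesis.Theorems
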